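import Literature.NumberTheory.EllipticCurves.AnticyclotomicInertiaAboveP
import Literature.NumberTheory.EllipticCurves.InertiaAboveEllCyclotomicProofs
import Literature.NumberTheory.GaloisRepresentations.ArtinFormalismInductionProofs
import Literature.NumberTheory.Automorphic.AdicCompletionResidueCard
import Literature.NumberTheory.Automorphic.AdicCompletionLocalField
import HarnessLib

/-!
# Transport between the local Galois groups `Γ_{ℚ_p}` and `Γ_{K_v̄}` at a SPLIT prime of a quadratic field: decomposition,
# inertia and Frobenius elements correspond under one conjugation in `Γ_ℚ` (proofs only)

Topic `NumberTheory/EllipticCurves` (namespace `Literature.NumberTheory.EllipticCurves.ZpExtension`). THEOREMS ONLY (no definition,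
no named fact; D-0026). For a quadratic field `K`, an odd or even prime `p` SPLIT in `K` (`v ≠ v̄` above `p`) and the place `u = (p)`
of `ℚ` below `v̄`: there is `γ ∈ Γ_ℚ` such that EVERY `τ ∈ Γ_{K_v̄}` has `γ⁻¹ · res_{K/ℚ}(res_{K_v̄}(τ)) · γ = res_{ℚ_u}(x)` for some
`x ∈ Γ_{ℚ_u}`, with `x` in the inertia group when `τ` is, and `x` an arithmetic Frobenius when `τ` is (`f(v̄ ∣ p) = 1`).
Mechanism: `res_{K_v̄}(Γ_{K_v̄}) = D_{𝔓₀}` for the prime `𝔓₀` of `\bar ℤ_K` cut out by `K̄ → K̄_v̄`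
(`decompositionSubgroup_adicCompletionPrime_eq_range`), restriction to `\bar ℤ_ℚ` maps `D_{𝔓₀} → D_𝔔`, `I_{𝔓₀} → I_𝔔`, Frobenius to
Frobenius (`comap_decompositionSubgroup_comap_absIntegersMap`, `absGaloisRestrict_mem_inertia_comap`, `forall_smul_sub_pow_mem_comap_iff`
— the last because the residue degrees agree, `residueCard_eq_of_split`), `𝔔 = γ · 𝔓₀^ℚ` for the prime `𝔓₀^ℚ` cut out by `ℚ̄ → ℚ̄_u`
(transitivity, `exists_smul_eq_of_mem_primesAbove_holds`), and `D_{𝔓₀^ℚ} = res_{ℚ_u}(Γ_{ℚ_u})`, `I_{𝔓₀^ℚ} = res_{ℚ_u}(I_{ℚ_u})`,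
Frobenius ↔ Frobenius (`isArithFrobAt_absGaloisRestrict_adicCompletionPrime_iff`, Neukirch II (9.6)).

Use (cell `bsd-stepL`, crux 25505, stub (FIX), memo `LOCALDEFECT-25505-imc-p1-g23.md` §1ter row (e)): an ordinary frame `Q` of a
`Γ_ℚ`-representation `ρ` on `Γ_{ℚ_p}` ([Wiles88 Thm 2.2], the named fact `Hida2000_thm326_ordinary_unitRoot`) yields the frame `ρ(γ)Q` on
the image of `Γ_{K_v̄}` with the same clauses (`frame_transport_of_split`).

* `residueCard_eq_of_split` — `N(v̄) = N(u)` (`f = 1` from `r·e·f = 2`, `r = 2`);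
* `exists_conj_transport_of_split` — the element-wise transport (decomposition ∕ inertia ∕ Frobenius);
* `frame_transport_of_split` — transport of a frame property of a `GL₂`-valued representation of `Γ_ℚ`.

References: [NeukirchANT1999] Ch. I §9 (9.1)–(9.6), Ch. II §9 Prop. (9.6); [SerreLocalFields1979] Ch. I §8.
-/

noncomputable section

open Field NumberField IsDedekindDomain
open scoped Pointwise
open Literature.NumberTheory.GaloisRepresentations Literature.NumberTheory.EllipticCurves
open Literature.NumberTheory.Automorphic

namespace Literature.NumberTheory.EllipticCurves.ZpExtension

variable {K : Type} [Field K] [NumberField K] {p : ℕ} [Fact p.Prime]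

/-- **`f(v̄ ∣ p) = 1` at a split prime of a quadratic field**: `N(v̄) = N(u)` for the place `u` of `ℚ` below `v̄` (fundamental identity
`r·e·f = [K:ℚ] = 2` with `r = 2`). [cite: NeukirchANT1999, Ch. I §8 Prop. (8.2) and §9] -/
theorem residueCard_eq_of_split (hK2 : Module.finrank ℚ K = 2)
    {v vbar : HeightOneSpectrum (𝓞 K)} (hpv : ((p : ℕ) : 𝓞 K) ∈ v.asIdeal)
    (hpvbar : ((p : ℕ) : 𝓞 K) ∈ vbar.asIdeal) (hne : vbar ≠ v)
    {u : HeightOneSpectrum (𝓞 ℚ)} (hwu : vbar.asIdeal.under (𝓞 ℚ) = u.asIdeal) :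
    vbar.residueCard = u.residueCard := by
  haveI : Algebra.IsQuadraticExtension ℚ K := ⟨hK2⟩
  haveI : IsGalois ℚ K := inferInstance
  have hu₀eq : u = vbar.under (𝓞 ℚ) :=
    HeightOneSpectrum.ext (by rw [← hwu, HeightOneSpectrum.under_asIdeal])
  have hsplit : (u.asIdeal.primesOver (𝓞 K)).ncard = 2 := by
    rw [hu₀eq, ← hK2]
    exact ncard_primesOver_under_eq_finrank_of_ne hK2 hpvbar hpv hne.symm
  have hid := Ideal.ncard_primesOver_mul_ramificationIdxIn_mul_inertiaDegIn u.asIdeal (𝓞 K) (K ≃ₐ[ℚ] K)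
  rw [IsGalois.card_aut_eq_finrank, hK2, hsplit] at hid
  have hf : u.asIdeal.inertiaDegIn (𝓞 K) = 1 := by
    have h1 : u.asIdeal.ramificationIdxIn (𝓞 K) * u.asIdeal.inertiaDegIn (𝓞 K) = 1 := by omega
    exact (mul_eq_one.mp h1).2
  haveI : vbar.asIdeal.LiesOver u.asIdeal := ⟨hwu.symm⟩
  have hf' : vbar.asIdeal.inertiaDeg (𝓞 ℚ) = 1 := by
    rw [← Ideal.inertiaDegIn_eq_inertiaDeg u.asIdeal vbar.asIdeal (K ≃ₐ[ℚ] K)]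
    exact hf
  rw [residueCard_eq_pow_inertiaDeg_of_under_eq hwu, hf', pow_one]

/-- **Transport `Γ_{K_v̄} → Γ_{ℚ_u}` at a split prime, element-wise**: one `γ ∈ Γ_ℚ` conjugates the image of `Γ_{K_v̄}` in `Γ_ℚ` into the
image of `Γ_{ℚ_u}`, inertia into inertia, Frobenius to Frobenius. [cite: NeukirchANT1999, Ch. II §9 Prop. (9.6) with Ch. I §9 (9.1)–(9.6)] -/
theorem exists_conj_transport_of_split (hK2 : Module.finrank ℚ K = 2)
    {v vbar : HeightOneSpectrum (𝓞 K)} (hpv : ((p : ℕ) : 𝓞 K) ∈ v.asIdeal)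
    (hpvbar : ((p : ℕ) : 𝓞 K) ∈ vbar.asIdeal) (hne : vbar ≠ v)
    {u : HeightOneSpectrum (𝓞 ℚ)} (hwu : vbar.asIdeal.under (𝓞 ℚ) = u.asIdeal) :
    ∃ γ : absoluteGaloisGroup ℚ,
      (∀ τ : absoluteGaloisGroup (vbar.adicCompletion K), ∃ x : absoluteGaloisGroup (u.adicCompletion ℚ),
        absGaloisRestrict ℚ (u.adicCompletion ℚ) x =
          γ⁻¹ * absGaloisRestrict ℚ K (absGaloisRestrict K (vbar.adicCompletion K) τ) * γ) ∧
      (∀ τ ∈ absInertia (vbar.adicCompletion K), ∃ x ∈ absInertia (u.adicCompletion ℚ),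
        absGaloisRestrict ℚ (u.adicCompletion ℚ) x =
          γ⁻¹ * absGaloisRestrict ℚ K (absGaloisRestrict K (vbar.adicCompletion K) τ) * γ) ∧
      (∀ τ : absoluteGaloisGroup (vbar.adicCompletion K), IsAbsArithFrob τ →
        ∃ x : absoluteGaloisGroup (u.adicCompletion ℚ), IsAbsArithFrob x ∧
          absGaloisRestrict ℚ (u.adicCompletion ℚ) x =
            γ⁻¹ * absGaloisRestrict ℚ K (absGaloisRestrict K (vbar.adicCompletion K) τ) * γ) := by
  haveI : Algebra.IsQuadraticExtension ℚ K := ⟨hK2⟩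
  -- the three primes: `𝔓K` (cut out by `K̄ → K̄_v̄`), its contraction `𝔔`, and `𝔓Q` (cut out by `ℚ̄ → ℚ̄_u`)
  have h𝔓K : adicCompletionPrime K vbar ∈ vbar.primesAbove := adicCompletionPrime_mem_primesAbove K vbar
  have h𝔔 : (adicCompletionPrime K vbar).comap (absIntegersMap ℚ K) ∈ u.primesAbove :=
    comap_absIntegersMap_mem_primesAbove hwu h𝔓K
  have h𝔓Q : adicCompletionPrime ℚ u ∈ u.primesAbove := adicCompletionPrime_mem_primesAbove ℚ u
  obtain ⟨γ, hγ⟩ := HeightOneSpectrum.exists_smul_eq_of_mem_primesAbove_holds h𝔓Q h𝔔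
  -- notation
  set resK := absGaloisRestrict K (vbar.adicCompletion K) with hresK
  set resQ := absGaloisRestrict ℚ (u.adicCompletion ℚ) with hresQ
  set res := absGaloisRestrict ℚ K with hres
  -- (i) decomposition groups
  have hdec : ∀ τ : absoluteGaloisGroup (vbar.adicCompletion K), ∃ x : absoluteGaloisGroup (u.adicCompletion ℚ),
      resQ x = γ⁻¹ * res (resK τ) * γ := by
    intro τ
    have h1 : resK τ ∈ (adicCompletionPrime K vbar).decompositionSubgroup (absoluteGaloisGroup K) := by
      rw [decompositionSubgroup_adicCompletionPrime_eq_range]; exact ⟨τ, rfl⟩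
    have h2 : res (resK τ) ∈
        ((adicCompletionPrime K vbar).comap (absIntegersMap ℚ K)).decompositionSubgroup (absoluteGaloisGroup ℚ) := by
      rw [← comap_decompositionSubgroup_comap_absIntegersMap ℚ K (adicCompletionPrime K vbar)] at h1
      exact h1
    rw [← hγ, Ideal.decompositionSubgroup_smul, Subgroup.mem_pointwise_smul_iff_inv_smul_mem] at h2
    have h3 : γ⁻¹ * res (resK τ) * γ ∈ (adicCompletionPrime ℚ u).decompositionSubgroup (absoluteGaloisGroup ℚ) := by
      have e : (MulAut.conj γ)⁻¹ • res (resK τ) = γ⁻¹ * res (resK τ) * γ := by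
        rw [← map_inv, MulAut.smul_def, MulAut.conj_apply, inv_inv]
      rw [← e]; exact h2
    rw [decompositionSubgroup_adicCompletionPrime_eq_range] at h3
    obtain ⟨x, hx⟩ := h3
    exact ⟨x, hx⟩
  refine ⟨γ, hdec, ?_, ?_⟩
  · -- (ii) inertia
    intro τ hτ
    have h1 : resK τ ∈ (adicCompletionPrime K vbar).inertia (absoluteGaloisGroup K) := by
      rw [inertia_adicCompletionPrime_eq_map_absInertia K vbar]; exact Subgroup.mem_map_of_mem _ hτ
    have h2 : res (resK τ) ∈ ((adicCompletionPrime K vbar).comap (absIntegersMap ℚ K)).inertia (absoluteGaloisGroup ℚ) :=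
      absGaloisRestrict_mem_inertia_comap ℚ K h1
    rw [← hγ] at h2
    have h3 : γ⁻¹ * res (resK τ) * γ ∈ (adicCompletionPrime ℚ u).inertia (absoluteGaloisGroup ℚ) :=
      (HeightOneSpectrum.mem_inertia_smul_absIntegers_iff γ _ _).mp h2
    rw [inertia_adicCompletionPrime_eq_map_absInertia ℚ u, Subgroup.mem_map] at h3
    obtain ⟨x, hx, hxe⟩ := h3
    exact ⟨x, hx, hxe⟩
  · -- (iii) Frobenius
    intro τ hτ
    have hqK : IsNonarchimedeanLocalField.residueFieldCard (vbar.adicCompletion K) = Nat.card (𝓞 K ⧸ vbar.asIdeal) := by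
      rw [residueFieldCard_adicCompletion_eq K vbar, HeightOneSpectrum.residueCard_eq_card_quotient]
    have hqQ : IsNonarchimedeanLocalField.residueFieldCard (u.adicCompletion ℚ) = Nat.card (𝓞 ℚ ⧸ u.asIdeal) := by
      rw [residueFieldCard_adicCompletion_eq ℚ u, HeightOneSpectrum.residueCard_eq_card_quotient]
    have hF : IsArithFrobAt (𝓞 K) (resK τ) (adicCompletionPrime K vbar) :=
      (isArithFrobAt_absGaloisRestrict_adicCompletionPrime_iff K vbar hqK τ).mpr hτ
    have h1 := (HeightOneSpectrum.isArithFrobAt_iff_of_mem_primesAbove h𝔓K _).mp hF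
    have h2 : ∀ x : absIntegers (𝓞 ℚ) ℚ,
        res (resK τ) • x - x ^ vbar.residueCard ∈ (adicCompletionPrime K vbar).comap (absIntegersMap ℚ K) :=
      (forall_smul_sub_pow_mem_comap_iff ℚ K (adicCompletionPrime K vbar) (resK τ) _).mpr h1
    rw [residueCard_eq_of_split hK2 hpv hpvbar hne hwu] at h2
    -- conjugate down to `𝔓Q = γ⁻¹ 𝔔`
    have h3 : ∀ x : absIntegers (𝓞 ℚ) ℚ,
        (γ⁻¹ * res (resK τ) * γ) • x - x ^ u.residueCard ∈ adicCompletionPrime ℚ u := by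
      intro x
      have hx := h2 (γ • x)
      rw [← hγ, Ideal.mem_pointwise_smul_iff_inv_smul_mem, smul_sub, smul_pow', inv_smul_smul, ← mul_smul,
        ← mul_smul] at hx
      exact hx
    have h4 : IsArithFrobAt (𝓞 ℚ) (γ⁻¹ * res (resK τ) * γ) (adicCompletionPrime ℚ u) :=
      (HeightOneSpectrum.isArithFrobAt_iff_of_mem_primesAbove h𝔓Q _).mpr h3
    obtain ⟨x, hx⟩ := hdec τ
    refine ⟨x, ?_, hx⟩
    rw [← hx] at h4
    exact (isArithFrobAt_absGaloisRestrict_adicCompletionPrime_iff ℚ u hqQ x).mp h4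

/-- **Frame transport at a split prime.** Let `ρ : Γ_ℚ → GL₂(A)` and `Q ∈ GL₂(A)` be a frame on `Γ_{ℚ_u}`: for every `x ∈ Γ_{ℚ_u}` the
matrix `T = Q⁻¹ρ(res x)Q` satisfies `P₁ T`, `P₂ (res x) T` if `x` is in the inertia group, and `P₃ T` if `x` is an arithmetic Frobenius,
where the inertia clause `P₂ g T` depends on the global element `g` only up to conjugation (e.g. through `χ_cyc(g)`). Then
`Q' = ρ(γ)Q` is a frame on the image of `Γ_{K_v̄}` with the same three clauses. (The ordinary frame of [Wiles 1988, Thm 2.2] ∕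
`Hida2000_thm326_ordinary_unitRoot` moved to `Γ_{K_v̄}`.) [cite: NeukirchANT1999, Ch. II §9 Prop. (9.6) with Ch. I §9 (9.1)–(9.6)] -/
theorem frame_transport_of_split (hK2 : Module.finrank ℚ K = 2)
    {v vbar : HeightOneSpectrum (𝓞 K)} (hpv : ((p : ℕ) : 𝓞 K) ∈ v.asIdeal)
    (hpvbar : ((p : ℕ) : 𝓞 K) ∈ vbar.asIdeal) (hne : vbar ≠ v)
    {u : HeightOneSpectrum (𝓞 ℚ)} (hwu : vbar.asIdeal.under (𝓞 ℚ) = u.asIdeal)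
    {A : Type*} [CommRing A] [TopologicalSpace A] (ρ : FramedGaloisRep ℚ A 2) (Q : GL (Fin 2) A)
    (P₁ P₃ : GL (Fin 2) A → Prop) (P₂ : absoluteGaloisGroup ℚ → GL (Fin 2) A → Prop)
    (hP₂ : ∀ (γ g : absoluteGaloisGroup ℚ) (T : GL (Fin 2) A), P₂ (γ⁻¹ * g * γ) T → P₂ g T)
    (hW : ∀ x : absoluteGaloisGroup (u.adicCompletion ℚ),
      P₁ (Q⁻¹ * ρ (absGaloisRestrict ℚ (u.adicCompletion ℚ) x) * Q) ∧
      (x ∈ absInertia (u.adicCompletion ℚ) →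
        P₂ (absGaloisRestrict ℚ (u.adicCompletion ℚ) x) (Q⁻¹ * ρ (absGaloisRestrict ℚ (u.adicCompletion ℚ) x) * Q)) ∧
      (IsAbsArithFrob x → P₃ (Q⁻¹ * ρ (absGaloisRestrict ℚ (u.adicCompletion ℚ) x) * Q))) :
    ∃ Q' : GL (Fin 2) A, ∀ τ : absoluteGaloisGroup (vbar.adicCompletion K),
      P₁ (Q'⁻¹ * ρ (absGaloisRestrict ℚ K (absGaloisRestrict K (vbar.adicCompletion K) τ)) * Q') ∧
      (τ ∈ absInertia (vbar.adicCompletion K) →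
        P₂ (absGaloisRestrict ℚ K (absGaloisRestrict K (vbar.adicCompletion K) τ))
          (Q'⁻¹ * ρ (absGaloisRestrict ℚ K (absGaloisRestrict K (vbar.adicCompletion K) τ)) * Q')) ∧
      (IsAbsArithFrob τ →
        P₃ (Q'⁻¹ * ρ (absGaloisRestrict ℚ K (absGaloisRestrict K (vbar.adicCompletion K) τ)) * Q')) := by
  obtain ⟨γ, hdec, hin, hfr⟩ := exists_conj_transport_of_split hK2 hpv hpvbar hne hwu
  refine ⟨ρ γ * Q, fun τ ↦ ?_⟩
  -- `(ρ(γ)Q)⁻¹ ρ(g) (ρ(γ)Q) = Q⁻¹ ρ(γ⁻¹ g γ) Q = Q⁻¹ ρ(res x) Q`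
  have key : ∀ {x : absoluteGaloisGroup (u.adicCompletion ℚ)},
      absGaloisRestrict ℚ (u.adicCompletion ℚ) x =
        γ⁻¹ * absGaloisRestrict ℚ K (absGaloisRestrict K (vbar.adicCompletion K) τ) * γ →
      (ρ γ * Q)⁻¹ * ρ (absGaloisRestrict ℚ K (absGaloisRestrict K (vbar.adicCompletion K) τ)) * (ρ γ * Q) =
        Q⁻¹ * ρ (absGaloisRestrict ℚ (u.adicCompletion ℚ) x) * Q := by
    intro x hx
    rw [hx, map_mul, map_mul, map_inv, mul_inv_rev]
    group
  obtain ⟨x, hx⟩ := hdec τ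
  refine ⟨?_, fun hτ ↦ ?_, fun hτ ↦ ?_⟩
  · rw [key hx]; exact (hW x).1
  · obtain ⟨y, hyI, hy⟩ := hin τ hτ
    rw [key hy]
    exact hP₂ γ _ _ (hy ▸ (hW y).2.1 hyI)
  · obtain ⟨y, hyF, hy⟩ := hfr τ hτ
    rw [key hy]
    exact (hW y).2.2 hyF

end Literature.NumberTheory.EllipticCurves.ZpExtension

end
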